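import Summits.QuantumFields.BalabanUV.T4Continuum.Support.NE7CurvedLiftBookkeeping
import HarnessLib

/-!
# NE7CurvedLiftBookkeepingApprox — F55's curved (APE) bootstrap with APPROXIMATE HESSIAN ORTHOGONALITY of the normal part:
# `|hess W A_N Y| ≤ ν‖Y‖₁` on `W`-tangents instead of `= 0` — the honest letter at a CURVED, merely tangent-critical background — giving
# `SmallField (We^{A}) (x + K_G(τ + ρ + κ + ν) + c_N + 28α₀²)`

Cell `pub-balaban`, rung (B)+1 sub-cell t4, lineage `b2b-balaban-t4-ne7-p1` (CRUX PROVER NE7 #1 = OWNER of row NE7), generation 75.  File F59, over F55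
`NE7CurvedLiftBookkeeping` (this generation, p410174).

WHY (a design point of the curved programme, located this generation).  F55 carried F44's Hessian-orthogonality letter (hNorth) verbatim: `hess W A_N Y = 0` for
EVERY skew periodic `W`-tangent `Y`.  At the FLAT datum this is dischargeable for the B5 Landau lift `R_H B` (F40b) because the flat configuration is a FREE critical
point: gauge directions lie in the kernel of `hess 1`.  At a CURVED background `W` that is only TANGENT-critical (a constrained minimiser on its fibre carries a
non-zero Lagrange multiplier on normal directions), `Y ↦ hess W X Y` does NOT vanish on the fine gauge directions inside the tangent space — `hess V X Y =
∂_s∂_t A((Ve^{sX})e^{tY})` picks up `−dAction W (∂_s gaugeDir_{We^{sX}} λ)`, of the size of the multiplier times `‖X‖‖λ‖` — so an EXACT Hessian-orthogonal lift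
on all tangents is the wrong letter there (ill-conditioned on the gauge part).  The bootstrap needs only a BOUND: if `|hess W A_N Y| ≤ ν‖Y‖₁` on `W`-tangents,
F55's source estimate becomes `|hess W (A − A_N) Y| ≤ (τ + ρ + κ + ν)‖Y‖₁` and everything else is unchanged.  THIS FILE is that variant; `ν = 0` recovers F55.

WHAT ([folklore]; 0 def, 0 sorry).  **`smallField_vary_of_curvedLetters_approxNorth`** — F55's `smallField_vary_of_curvedLetters` with (hNorth) replaced by
(hNorthν) `∀ Y` skew periodic `W`-tangent, `|hess W A_N Y (perWin d P)| ≤ ν·dirL1 Y (periodBox P)` (`ν ≥ 0`); conclusion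
`SmallField (vary W A 1) (x + (K_G(τ + ρ + κ + ν) + c_N + 28α₀²))`.
HONEST FRAMING (page 1): bookkeeping composition over displayed letters; nothing of Bałaban's asserted; (APE) on curved data NOT proved; NOT ONE-STEP, NOT NE7; spine
0∕9; finite T⁴ rung (B)+1 — NOT infinite volume, NOT mass gap, NOT `BetaPertH`, NOT Clay.  Continuum YM on T⁴ ⇐ BetaPertH ∧ nine spine estimates (0/9 proved);
BetaPertH ⇐ (D1) ∧ (D4) ∧ CAP+tail; G-an2-4 gates asym, D1 and NE2/3/4.
-/

set_option autoImplicit false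

open scoped BigOperators Matrix Matrix.Norms.L2Operator
open NormedSpace Finset Set

namespace Summit.QuantumFields.BalabanUV.T4Continuum.NE7CurvedLiftBookkeepingApprox

open Literature.MathematicalPhysics.QuantumFieldTheory.Balaban1983to89
open B7Prop1Explicit B7Prop2Explicit MatrixLog UnitaryModel
open T4AveragingDeficitWall (IsUnitaryCfg IsSkewDir SmallField vary curlAt dirL1 vary_zero)
open T4AveragingDeficitWallBoundary (IsPeriodicCfg periodBox)
open AveragingDeficitPeriodicCounting (IsPeriodicDir)
open AveragingDeficitMultiLevelPrep (LevelSmall)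
open MinimalActionLevels (perWin)
open NE3HessForm (hess dAction)
open NE3TangentCovariantTower (dirIter)
open NE3ResidualSliceRep (dirIter_sub)
open NE3EnergyHessBilin (hess_add_left curlAt_add)
open NE7ExactCurrent (dAction_add)
open NE7CurvedLiftBookkeeping (norm_hol_vary_sub_one_le_of_curl_W)

noncomputable section

variable {d : ℕ} {n : Type*} [Fintype n] [DecidableEq n]

/-- **F55 WITH APPROXIMATE HESSIAN ORTHOGONALITY** (statement in the module docstring): the curved bootstrap with `|hess W A_N Y| ≤ ν‖Y‖₁` on `W`-tangents in
place of `= 0`; conclusion `SmallField (vary W A 1) (x + (K_G(τ + ρ + κ + ν) + c_N + 28α₀²))`. [folklore] -/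
theorem smallField_vary_of_curvedLetters_approxNorth [Nonempty n] {L : ℕ} (hL : 1 ≤ L) (k : ℕ) {P : ℕ}
    {W : Site d → Fin d → (Matrix n n ℂ)ˣ} (hW : IsUnitaryCfg W)
    {x : ℝ} (hx : 0 ≤ x) (hs : LevelSmall d L k x) (hWx : SmallField W x)
    {A : Site d → Fin d → Matrix n n ℂ} (hA : IsSkewDir A) (hAP : IsPeriodicDir A (P : ℤ)) {α₀ : ℝ} (hAα : ∀ y μ, ‖A y μ‖ ≤ α₀)
    {AN : Site d → Fin d → Matrix n n ℂ} (hNP : IsPeriodicDir AN (P : ℤ))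
    (hNexact : dirIter L (k + 1) W AN = dirIter L (k + 1) W A)
    {cN : ℝ} (hN7 : ∀ z μ' ν', μ' ≠ ν' → ‖curlAt W AN z μ' ν'‖ ≤ cN)
    {ν : ℝ} (hν : 0 ≤ ν)
    (hNorth : ∀ Y : Site d → Fin d → Matrix n n ℂ, IsSkewDir Y → IsPeriodicDir Y (P : ℤ) → dirIter L (k + 1) W Y = 0 →
      |hess W AN Y (perWin d P)| ≤ ν * dirL1 Y (periodBox (d := d) P))
    (S : Set (Site d → Fin d → Matrix n n ℂ)) (hTS : (fun y μ => A y μ - AN y μ) ∈ S) {KG : ℝ}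
    (hG : ∀ X ∈ S, IsPeriodicDir X (P : ℤ) → dirIter L (k + 1) W X = 0 → ∀ g : ℝ, 0 ≤ g →
      (∀ Y : Site d → Fin d → Matrix n n ℂ, IsSkewDir Y → IsPeriodicDir Y (P : ℤ) → dirIter L (k + 1) W Y = 0 →
        |hess W X Y (perWin d P)| ≤ g * dirL1 Y (periodBox (d := d) P)) →
      ∀ z μ' ν', μ' ≠ ν' → ‖curlAt W X z μ' ν'‖ ≤ KG * g)
    {ρ : ℝ} (hρ : 0 ≤ ρ)
    (hEXP : ∀ Y : Site d → Fin d → Matrix n n ℂ, IsSkewDir Y → IsPeriodicDir Y (P : ℤ) →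
      |dAction (vary W A 1) Y (perWin d P) - dAction W Y (perWin d P) - hess W A Y (perWin d P)| ≤ ρ * dirL1 Y (periodBox (d := d) P))
    {κ : ℝ} (hκ : 0 ≤ κ)
    (hWten : ∀ Y : Site d → Fin d → Matrix n n ℂ, IsSkewDir Y → IsPeriodicDir Y (P : ℤ) → dirIter L (k + 1) W Y = 0 →
      |dAction W Y (perWin d P)| ≤ κ * dirL1 Y (periodBox (d := d) P))
    (hcrit : ∀ Y' : Site d → Fin d → Matrix n n ℂ, IsSkewDir Y' → IsPeriodicDir Y' (P : ℤ) → dirIter L (k + 1) (vary W A 1) Y' = 0 →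
      dAction (vary W A 1) Y' (perWin d P) = 0)
    {τ : ℝ} (hτ : 0 ≤ τ)
    (hTT : ∀ Y : Site d → Fin d → Matrix n n ℂ, IsSkewDir Y → IsPeriodicDir Y (P : ℤ) → dirIter L (k + 1) W Y = 0 →
      ∃ Y' : Site d → Fin d → Matrix n n ℂ, IsSkewDir Y' ∧ IsPeriodicDir Y' (P : ℤ) ∧ dirIter L (k + 1) (vary W A 1) Y' = 0 ∧
        |dAction (vary W A 1) (fun y μ => Y' y μ - Y y μ) (perWin d P)| ≤ τ * dirL1 Y (periodBox (d := d) P)) :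
    SmallField (vary W A 1) (x + (KG * (τ + ρ + κ + ν) + cN + 28 * α₀ ^ 2)) := by
  set X : Site d → Fin d → Matrix n n ℂ := fun y μ => A y μ - AN y μ with hXdef
  have hXP : IsPeriodicDir X (P : ℤ) := fun y i μ => by simp only [hXdef, hAP y i μ, hNP y i μ]
  have hXT : dirIter L (k + 1) W X = 0 := by
    rw [hXdef, dirIter_sub hL k hW hx hs hWx A AN, hNexact]
    funext z κ
    simp
  have hsrc : ∀ Y : Site d → Fin d → Matrix n n ℂ, IsSkewDir Y → IsPeriodicDir Y (P : ℤ) → dirIter L (k + 1) W Y = 0 →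
      |hess W X Y (perWin d P)| ≤ (τ + ρ + κ + ν) * dirL1 Y (periodBox (d := d) P) := by
    intro Y hY hYP hYT
    have hsplitA : A = X + AN := by funext y μ; simp [hXdef]
    have hhess : hess W X Y (perWin d P) = hess W A Y (perWin d P) - hess W AN Y (perWin d P) := by
      have h := hess_add_left W (perWin d P) X AN Y
      rw [← hsplitA] at h
      linarith
    have hNν := hNorth Y hY hYP hYT
    obtain ⟨Y', hY's, hY'P, hY'T, hY'd⟩ := hTT Y hY hYP hYT
    have hc := hcrit Y' hY's hY'P hY'T
    have hdec : dAction (vary W A 1) Y (perWin d P)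
        = dAction (vary W A 1) Y' (perWin d P) - dAction (vary W A 1) (fun y μ => Y' y μ - Y y μ) (perWin d P) := by
      have hYsum : Y' = Y + fun y μ => Y' y μ - Y y μ := by funext y μ; simp
      have h := dAction_add (vary W A 1) Y (fun y μ => Y' y μ - Y y μ) (perWin d P)
      rw [← hYsum] at h
      linarith
    have hdA : |dAction (vary W A 1) Y (perWin d P)| ≤ τ * dirL1 Y (periodBox (d := d) P) := by
      rw [hdec, hc, zero_sub, abs_neg]
      exact hY'd
    have hE := hEXP Y hY hYP
    have hK := hWten Y hY hYP hYT
    have htri : |hess W A Y (perWin d P)| ≤ |dAction (vary W A 1) Y (perWin d P)|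
        + |dAction (vary W A 1) Y (perWin d P) - dAction W Y (perWin d P) - hess W A Y (perWin d P)| + |dAction W Y (perWin d P)| := by
      have h := abs_sub_le (hess W A Y (perWin d P)) (dAction (vary W A 1) Y (perWin d P) - dAction W Y (perWin d P)) 0
      have h1 : |hess W A Y (perWin d P) - (dAction (vary W A 1) Y (perWin d P) - dAction W Y (perWin d P))|
          = |dAction (vary W A 1) Y (perWin d P) - dAction W Y (perWin d P) - hess W A Y (perWin d P)| := by
        rw [abs_sub_comm]
      have h2 : |dAction (vary W A 1) Y (perWin d P) - dAction W Y (perWin d P) - 0|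
          ≤ |dAction (vary W A 1) Y (perWin d P)| + |dAction W Y (perWin d P)| := by
        rw [sub_zero]; exact abs_sub _ _
      rw [sub_zero] at h
      linarith
    have hAbd : |hess W A Y (perWin d P)|
        ≤ τ * dirL1 Y (periodBox (d := d) P) + ρ * dirL1 Y (periodBox (d := d) P) + κ * dirL1 Y (periodBox (d := d) P) := by linarith
    rw [hhess]
    calc |hess W A Y (perWin d P) - hess W AN Y (perWin d P)|
        ≤ |hess W A Y (perWin d P)| + |hess W AN Y (perWin d P)| := abs_sub _ _
      _ ≤ (τ * dirL1 Y (periodBox (d := d) P) + ρ * dirL1 Y (periodBox (d := d) P) + κ * dirL1 Y (periodBox (d := d) P))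
          + ν * dirL1 Y (periodBox (d := d) P) := add_le_add hAbd hNν
      _ = (τ + ρ + κ + ν) * dirL1 Y (periodBox (d := d) P) := by ring
  have hcurlX : ∀ z μ' ν', μ' ≠ ν' → ‖curlAt W X z μ' ν'‖ ≤ KG * (τ + ρ + κ + ν) :=
    hG X hTS hXP hXT (τ + ρ + κ + ν) (add_nonneg (add_nonneg (add_nonneg hτ hρ) hκ) hν) hsrc
  have hcurlA : ∀ z μ' ν', μ' ≠ ν' → ‖curlAt W A z μ' ν'‖ ≤ KG * (τ + ρ + κ + ν) + cN := by
    intro z μ' ν' hμν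
    have hsplit : A = X + AN := by funext y κ; simp [hXdef]
    rw [hsplit, curlAt_add]
    exact (norm_add_le _ _).trans (add_le_add (hcurlX z μ' ν' hμν) (hN7 z μ' ν' hμν))
  intro z μ' ν' hμν
  have h := norm_hol_vary_sub_one_le_of_curl_W hW hA hAα z (hWx z μ' ν' hμν) (hcurlA z μ' ν' hμν)
  linarith


end

end Summit.QuantumFields.BalabanUV.T4Continuum.NE7CurvedLiftBookkeepingApprox
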